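import Literature.NumberTheory.Transcendental.CurvePeriodsEllipticFormsProofs

/-!
# `RealOnePeriodRelations` (stmt-KontsevichZagierPeriods-10042), line `nash-retraction-thin-strip`,
# loop layer: stub `stub_branchForm`

`c₀ dx/y` AS A POLYNOMIAL FORM, AT COMPLEX POINTS.  On the affine Weierstrass curve
`E_{A,B} : y² = f(x)`, `f = x³ + Ax + B`, with `D = 4A³ + 27B² ≠ 0`, the tree's Bézout identity
(`Weier.bezout`, `Weier.eval_bezout`)

  `V f′ − U f = D`,  `U = 18Ax − 27B`, `V = 6Ax² − 9Bx + 4A²`, `f′ = 3x² + A`,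

gives `1/Y = (V(X) f′(X) − U(X) Y²)/(D Y)` at every COMPLEX point `(X, Y)` of the curve with `Y ≠ 0`.
Hence the constant multiple `c₀ dx/y` of the invariant differential is the restriction of the
polynomial 1-form `G dx + H dy` with

  `G = −c₀ D⁻¹ U · y`,  `H = 2 c₀ D⁻¹ V`,

in the sense `G + H · f′(X)/(2Y) = c₀/Y` (along the curve `dy = f′/(2y) dx`); both `G` and `H` have
algebraic coefficients when `A, B, c₀` are algebraic. [folklore]
-/

noncomputable section

open scoped BigOperators Polynomial
open Literature.NumberTheory.Transcendental Literature.NumberTheory.Transcendental.CurvePeriods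

namespace Summit.KontsevichZagierPeriods.SymplecticScissors.RealOnePeriodRelations.LoopLayer

/-- **Stub `stub_branchForm`** — `c₀ dx/y` AS A POLYNOMIAL FORM, AT COMPLEX POINTS.  With the Bézout
identity `V f′ − U f = D` (`Weier.bezout`): `c₀/Y = G(X,Y) + H(X,Y) f′(X)/(2Y)` for all complex `(X, Y)`
on `Y² = f(X)`, `Y ≠ 0`, with `G = −c₀ (U/D) Y`, `H = (2c₀/D) V` polynomial over `ℚ̄`. [folklore] -/
theorem stub_branchForm : ∀ (A B c₀ : ℝ), IsAlgebraic ℚ A → IsAlgebraic ℚ B → IsAlgebraic ℚ c₀ →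
    4 * A ^ 3 + 27 * B ^ 2 ≠ 0 →
    ∃ G H : MvPolynomial (Fin 2) ℂ, HasAlgCoeffs G ∧ HasAlgCoeffs H ∧
      ∀ (X Y : ℂ), Y ^ 2 = X ^ 3 + (A : ℂ) * X + (B : ℂ) → Y ≠ 0 →
        MvPolynomial.eval ![X, Y] G + MvPolynomial.eval ![X, Y] H * ((3 * X ^ 2 + (A : ℂ)) / (2 * Y)) =
          (c₀ : ℂ) / Y := by
  intro A B c₀ hA hB hc hD
  have hAC : IsAlgebraic ℚ (A : ℂ) := hA.algebraMap
  have hBC : IsAlgebraic ℚ (B : ℂ) := hB.algebraMap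
  have hcC : IsAlgebraic ℚ (c₀ : ℂ) := hc.algebraMap
  have hDC : Weier.disc (A : ℂ) (B : ℂ) ≠ 0 := by
    show (4 * (A : ℂ) ^ 3 + 27 * (B : ℂ) ^ 2) ≠ 0
    exact_mod_cast hD
  have hDinv : IsAlgebraic ℚ (Weier.disc (A : ℂ) (B : ℂ))⁻¹ := (Weier.isAlgebraic_disc _ _ hAC hBC).inv
  refine ⟨MvPolynomial.C (-(c₀ : ℂ) * (Weier.disc (A : ℂ) (B : ℂ))⁻¹) * Weier.uPol (A : ℂ) (B : ℂ) *
      MvPolynomial.X 1,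
    MvPolynomial.C (2 * (c₀ : ℂ) * (Weier.disc (A : ℂ) (B : ℂ))⁻¹) * Weier.vPol (A : ℂ) (B : ℂ),
    ?_, ?_, ?_⟩
  · exact ((hasAlgCoeffs_C (hcC.neg.mul hDinv)).mul (Weier.hasAlgCoeffs_uPol _ _ hAC hBC)).mul
      (hasAlgCoeffs_X 1)
  · exact (hasAlgCoeffs_C (((isAlgebraic_nat 2).mul hcC).mul hDinv)).mul
      (Weier.hasAlgCoeffs_vPol _ _ hAC hBC)
  · intro X Y hXY hY
    have hYinv : Y * Y⁻¹ = 1 := mul_inv_cancel₀ hY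
    have hE : Weier.disc (A : ℂ) (B : ℂ) * (Weier.disc (A : ℂ) (B : ℂ))⁻¹ = 1 := mul_inv_cancel₀ hDC
    have hbez := Weier.eval_bezout (A : ℂ) (B : ℂ) ![X, Y]
    rw [Weier.eval_pderiv_zero_fPoly, Weier.eval_fPoly] at hbez
    simp only [Matrix.cons_val_zero] at hbez
    simp only [map_mul, MvPolynomial.eval_C, MvPolynomial.eval_X, Matrix.cons_val_one,
      Matrix.cons_val_zero]
    rw [div_eq_mul_inv, div_eq_mul_inv]
    linear_combination
      ((c₀ : ℂ) * (Weier.disc (A : ℂ) (B : ℂ))⁻¹ * Y⁻¹) * hbez -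
      ((c₀ : ℂ) * (Weier.disc (A : ℂ) (B : ℂ))⁻¹ * Y⁻¹ *
        MvPolynomial.eval ![X, Y] (Weier.uPol (A : ℂ) (B : ℂ))) * hXY +
      ((c₀ : ℂ) * (Weier.disc (A : ℂ) (B : ℂ))⁻¹ *
        MvPolynomial.eval ![X, Y] (Weier.uPol (A : ℂ) (B : ℂ)) * Y) * hYinv +
      ((c₀ : ℂ) * Y⁻¹) * hE

end Summit.KontsevichZagierPeriods.SymplecticScissors.RealOnePeriodRelations.LoopLayer

end
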